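import Summits.SmoothPoincare4.SmoothPoincare4.Theorems.EntropyRungNoncompactShrinkerGapHeatFisherCutoff

/-!
# The time derivative of the cut-off entropy along the weighted heat flow on a complete weighted manifold
# (crux `EntropyRung.NoncompactShrinkerGap`, stmt-SmoothPoincare4-10868, line `collapsed-ends-usc`, v13)

Helper of the registered stub `stub_compactSupportLSI` (heat-flow proof of the compact-support logarithmic Sobolev
inequality on the complete shrinker): the non-compact, cut-off version of `dH/dt = −I` (Carrillo–Ni 2009, (3.2)).
For `(M, g)` modelled on `ℝⁿ` (NOT compact), a smooth weight `V`, `L = Δ − g⁻¹(dV, d·)`, a positive `ρ` smooth on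
`M × S` with `∂ₜρ = Lρ`, and a smooth COMPACTLY SUPPORTED `η`, at every `t ∈ S`:

  `∫ η ∂ₜ(ρ log ρ e^{-V}) dV = −∫ η |∇ρ|²/ρ e^{-V} dV + ∫ (ρ log ρ)(Lη) e^{-V} dV`      (`entropyCutoff_eq`).

Proof: `∂ₜ(ρ log ρ) = (1 + log ρ) Lρ`; the weighted Green identity with the compactly supported factor
`η (1 + log ρ)` gives `−∫ η ⟨d log ρ, dρ⟩ e^{-V} − ∫ (1 + log ρ)⟨dη, dρ⟩ e^{-V}`; the first term is `−∫ η|∇ρ|²/ρ e^{-V}`,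
and since `(1 + log ρ) dρ = d(ρ log ρ)` the second is `∫ (ρ log ρ)(Lη) e^{-V}` by the weighted Green identity with
the compactly supported factor `η`. The last ("boundary") term is the only new feature relative to the closed case
(`hasDerivAt_entropy`, `BakryEmeryHeatFlow.lean`). Everything is proved; no definitions.
-/

noncomputable section

set_option linter.dupNamespace false

open scoped Manifold ContDiff ENNReal NNReal Topology
open MeasureTheory Set Filter
open Literature.Geometry.Lorentzian Literature.Geometry.Riemannian

namespace Summit.SmoothPoincare4.SmoothPoincare4.Theorems.NoncompactShrinkerGapHeat

section Entropy

variable {n : ℕ} {M : Type*} [TopologicalSpace M] [T2Space M] [SecondCountableTopology M]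
  [ChartedSpace (EuclideanSpace ℝ (Fin n)) M] [IsManifold (𝓡 n) ∞ M] [T3Space M] [MeasurableSpace M]
  [BorelSpace M]
  {g : PseudoRiemannianMetric (𝓡 n) ∞ (EuclideanSpace ℝ (Fin n)) (TangentSpace (𝓡 n) : M → Type _)}
  [g.HasLeviCivita]

omit [T2Space M] [SecondCountableTopology M] [T3Space M] [MeasurableSpace M] [BorelSpace M] [g.HasLeviCivita] in
/-- `g⁻¹(d(log ρ), β) = ρ⁻¹ g⁻¹(dρ, β)` at a point where `ρ > 0`. [folklore] -/
theorem innerDual_mvfderiv_log_left {ρ : M → ℝ} {x : M} (hρ : MDifferentiableAt (𝓡 n) 𝓘(ℝ, ℝ) ρ x)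
    (hpos : 0 < ρ x) (β : Module.Dual ℝ (TangentSpace (𝓡 n) x)) :
    g.innerDual x (mvfderiv (𝓡 n) (fun y ↦ Real.log (ρ y)) x).toLinearMap β =
      (ρ x)⁻¹ * g.innerDual x (mvfderiv (𝓡 n) ρ x).toLinearMap β := by
  have hd : HasDerivAt Real.log (ρ x)⁻¹ (ρ x) := Real.hasDerivAt_log hpos.ne'
  have hlin : (mvfderiv (𝓡 n) (fun y ↦ Real.log (ρ y)) x).toLinearMap =
      (ρ x)⁻¹ • (mvfderiv (𝓡 n) ρ x).toLinearMap := by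
    ext v
    have := mvfderiv_real_comp_apply (I := 𝓡 n) hd hρ v
    simpa [Function.comp_def] using this
  rw [hlin, g.innerDual_smul_left]

omit [T2Space M] [SecondCountableTopology M] [T3Space M] [MeasurableSpace M] [BorelSpace M] [g.HasLeviCivita] in
/-- `g⁻¹(d(ρ log ρ), β) = (1 + log ρ) g⁻¹(dρ, β)` at a point where `ρ > 0`. [folklore] -/
theorem innerDual_mvfderiv_mul_log_left {ρ : M → ℝ} {x : M} (hρ : MDifferentiableAt (𝓡 n) 𝓘(ℝ, ℝ) ρ x)
    (hpos : 0 < ρ x) (β : Module.Dual ℝ (TangentSpace (𝓡 n) x)) :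
    g.innerDual x (mvfderiv (𝓡 n) (fun y ↦ ρ y * Real.log (ρ y)) x).toLinearMap β =
      (1 + Real.log (ρ x)) * g.innerDual x (mvfderiv (𝓡 n) ρ x).toLinearMap β := by
  have hlog : MDifferentiableAt (𝓡 n) 𝓘(ℝ, ℝ) (fun y ↦ Real.log (ρ y)) x :=
    ((Real.hasDerivAt_log hpos.ne').differentiableAt).comp_mdifferentiableAt hρ
  rw [innerDual_mvfderiv_mul_left hρ hlog, innerDual_mvfderiv_log_left hρ hpos]
  field_simp

/-- **The time derivative of the cut-off entropy** on a (non-compact) Riemannian manifold modelled on `ℝⁿ`: for a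
positive `ρ` smooth on `M × S` with `∂ₜρ = Lρ` (`L = Δ − g⁻¹(dV, d·)`) and a smooth compactly supported `η`, at
`t ∈ S`, `∫ η ∂ₜ(ρ log ρ e^{-V}) = −∫ η |∇ρ|²/ρ e^{-V} + ∫ (ρ log ρ)(Lη) e^{-V}`.
[cite: CarrilloNi2009, §3 (3.2)] -/
theorem entropyCutoff_eq (hg : g.IsRiemannian) {V : M → ℝ} (hV : ContMDiff (𝓡 n) 𝓘(ℝ, ℝ) ∞ V)
    {ρ : ℝ → M → ℝ} {S : Set ℝ} (hS : UniqueDiffOn ℝ S)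
    (hρ : ContMDiffOn ((𝓡 n).prod 𝓘(ℝ, ℝ)) 𝓘(ℝ, ℝ) ∞ (fun p : M × ℝ ↦ ρ p.2 p.1) (univ ×ˢ S))
    (hpos : ∀ t ∈ S, ∀ y, 0 < ρ t y)
    (heq : ∀ t ∈ S, ∀ y : M, derivWithin (fun s ↦ ρ s y) S t =
      g.dalembertian (ρ t) y
        - g.innerDual y (mvfderiv (𝓡 n) V y).toLinearMap (mvfderiv (𝓡 n) (ρ t) y).toLinearMap)
    {η : M → ℝ} (hη : ContMDiff (𝓡 n) 𝓘(ℝ, ℝ) ∞ η) (hηc : HasCompactSupport η) {t : ℝ} (ht : t ∈ S) :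
    ∫ y, η y * derivWithin (fun s ↦ ρ s y * Real.log (ρ s y) * Real.exp (-V y)) S t ∂g.riemVolume =
      -(∫ y, η y * (g.gradSq (ρ t) y / ρ t y * Real.exp (-V y)) ∂g.riemVolume)
      + ∫ y, ρ t y * Real.log (ρ t y) * (g.dalembertian η y
          - g.innerDual y (mvfderiv (𝓡 n) V y).toLinearMap (mvfderiv (𝓡 n) η y).toLinearMap)
          * Real.exp (-V y) ∂g.riemVolume := by
  -- the slice at time `t` and its regularity
  have hF : ContMDiff (𝓡 n) 𝓘(ℝ, ℝ) ∞ (ρ t) :=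
    hρ.comp_contMDiff (contMDiff_id.prodMk contMDiff_const) fun y ↦ ⟨mem_univ _, ht⟩
  have hF1 : ContMDiff (𝓡 n) 𝓘(ℝ, ℝ) 1 (ρ t) := hF.of_le (by norm_num)
  have hF2 : ContMDiff (𝓡 n) 𝓘(ℝ, ℝ) 2 (ρ t) := hF.of_le (WithTop.coe_le_coe.mpr le_top)
  have hV1 : ContMDiff (𝓡 n) 𝓘(ℝ, ℝ) 1 V := hV.of_le (by norm_num)
  have hη1 : ContMDiff (𝓡 n) 𝓘(ℝ, ℝ) 1 η := hη.of_le (by norm_num)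
  have hη2 : ContMDiff (𝓡 n) 𝓘(ℝ, ℝ) 2 η := hη.of_le (WithTop.coe_le_coe.mpr le_top)
  have hpt : ∀ y, 0 < ρ t y := hpos t ht
  have hlogF : ContMDiff (𝓡 n) 𝓘(ℝ, ℝ) ∞ (fun y ↦ Real.log (ρ t y)) := fun y ↦
    ((Real.contDiffAt_log.2 (hpt y).ne').contMDiffAt).comp y (hF y)
  have hlogF1 : ContMDiff (𝓡 n) 𝓘(ℝ, ℝ) 1 (fun y ↦ Real.log (ρ t y)) := hlogF.of_le (by norm_num)
  have hA : ContMDiff (𝓡 n) 𝓘(ℝ, ℝ) 1 (fun y ↦ η y * (1 + Real.log (ρ t y))) :=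
    hη1.mul (contMDiff_const.add hlogF1)
  have hAc : HasCompactSupport (fun y ↦ η y * (1 + Real.log (ρ t y))) := hηc.mul_right
  have hPL : ContMDiff (𝓡 n) 𝓘(ℝ, ℝ) 1 (fun y ↦ ρ t y * Real.log (ρ t y)) := hF1.mul hlogF1
  -- the pointwise time derivative: `∂ₜ(ρ log ρ e^{-V}) = (Lρ)(1 + log ρ) e^{-V}`
  have hfd : ∀ y, HasDerivWithinAt (fun s ↦ ρ s y) (derivWithin (fun s ↦ ρ s y) S t) S t := fun y ↦
    hasDerivWithinAt_time_of_contMDiffOn (by simp) hρ y ht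
  have hprod : ∀ y, derivWithin (fun s ↦ ρ s y * Real.log (ρ s y) * Real.exp (-V y)) S t =
      (g.dalembertian (ρ t) y
        - g.innerDual y (mvfderiv (𝓡 n) V y).toLinearMap (mvfderiv (𝓡 n) (ρ t) y).toLinearMap)
        * (1 + Real.log (ρ t y)) * Real.exp (-V y) := by
    intro y
    have hl : HasDerivWithinAt (fun s ↦ Real.log (ρ s y))
        ((ρ t y)⁻¹ * derivWithin (fun s ↦ ρ s y) S t) S t := by
      have := (Real.hasDerivAt_log (hpt y).ne').comp_hasDerivWithinAt t (hfd y)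
      simpa [Function.comp_def] using this
    have hm : HasDerivWithinAt (fun s ↦ ρ s y * Real.log (ρ s y))
        (derivWithin (fun s ↦ ρ s y) S t * Real.log (ρ t y)
          + ρ t y * ((ρ t y)⁻¹ * derivWithin (fun s ↦ ρ s y) S t)) S t := (hfd y).mul hl
    have h := (hm.mul_const (Real.exp (-V y))).derivWithin (hS t ht)
    have key : ρ t y * ((ρ t y)⁻¹ * derivWithin (fun s ↦ ρ s y) S t) = derivWithin (fun s ↦ ρ s y) S t := by
      rw [← mul_assoc, mul_inv_cancel₀ (hpt y).ne', one_mul]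
    rw [h, key, heq t ht y]
    ring
  -- continuity and integrability
  have hΔFc : Continuous (g.dalembertian (ρ t)) := continuous_dalembertian g hF2
  have hΔηc : Continuous (g.dalembertian η) := continuous_dalembertian g hη2
  have hIVF : Continuous fun y ↦ g.innerDual y (mvfderiv (𝓡 n) V y).toLinearMap
      (mvfderiv (𝓡 n) (ρ t) y).toLinearMap := continuous_innerDual_mvfderiv g hV1 hF1
  have hIVη : Continuous fun y ↦ g.innerDual y (mvfderiv (𝓡 n) V y).toLinearMap
      (mvfderiv (𝓡 n) η y).toLinearMap := continuous_innerDual_mvfderiv g hV1 hη1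
  have hIηF : Continuous fun y ↦ g.innerDual y (mvfderiv (𝓡 n) η y).toLinearMap
      (mvfderiv (𝓡 n) (ρ t) y).toLinearMap := continuous_innerDual_mvfderiv g hη1 hF1
  have hFc : Continuous (ρ t) := hF.continuous
  have hlogc : Continuous fun y ↦ Real.log (ρ t y) := hlogF.continuous
  have hQc : Continuous (g.gradSq (ρ t)) := (contMDiff_gradSq g hF).continuous
  have hWc : Continuous fun y ↦ Real.exp (-V y) := Real.continuous_exp.comp hV.continuous.neg
  have hηcont : Continuous η := hη.continuous
  have hKη : IsCompact (tsupport η) := hηc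
  have hdη0 : ∀ {G : M → ℝ}, ∀ y ∉ tsupport η, g.innerDual y (mvfderiv (𝓡 n) η y).toLinearMap
      (mvfderiv (𝓡 n) G y).toLinearMap = 0 := fun {G} y hy ↦
    innerDual_mvfderiv_eq_zero_of_notMem_tsupport_left hy
  have hLη0 : ∀ y ∉ tsupport η, g.dalembertian η y
      - g.innerDual y (mvfderiv (𝓡 n) V y).toLinearMap (mvfderiv (𝓡 n) η y).toLinearMap = 0 := by
    intro y hy
    rw [g.dalembertian_eq_zero_of_notMem_tsupport hy, innerDual_mvfderiv_eq_zero_of_notMem_tsupport_right hy]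
    ring
  -- rewrite the left-hand side with the Green identity for `a = η (1 + log ρ)`, `b = ρ`
  have hG := weightedGreen_left hg (a := fun y ↦ η y * (1 + Real.log (ρ t y))) (b := ρ t) (V := V)
    hA hAc hF2 hV1
  have iLHS : Integrable (fun y ↦ (η y * (1 + Real.log (ρ t y))) * (g.dalembertian (ρ t) y
      - g.innerDual y (mvfderiv (𝓡 n) V y).toLinearMap (mvfderiv (𝓡 n) (ρ t) y).toLinearMap)
      * Real.exp (-V y)) g.riemVolume :=
    integrable_of_continuous_of_hasCompactSupport' hg
      (((hηcont.mul (continuous_const.add hlogc)).mul (hΔFc.sub hIVF)).mul hWc) (hAc.mul_right.mul_right)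
  have e0 : ∫ y, η y * derivWithin (fun s ↦ ρ s y * Real.log (ρ s y) * Real.exp (-V y)) S t ∂g.riemVolume =
      ∫ y, (η y * (1 + Real.log (ρ t y))) * (g.dalembertian (ρ t) y
        - g.innerDual y (mvfderiv (𝓡 n) V y).toLinearMap (mvfderiv (𝓡 n) (ρ t) y).toLinearMap)
        * Real.exp (-V y) ∂g.riemVolume :=
    integral_congr_ae (Eventually.of_forall fun y ↦ by dsimp only; rw [hprod y]; ring)
  -- the right-hand side of Green: `⟨d(η(1 + log ρ)), dρ⟩ = (1 + log ρ)⟨dη, dρ⟩ + η |∇ρ|²/ρ`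
  have hgradF : ∀ y, g.innerDual y (mvfderiv (𝓡 n) (ρ t) y).toLinearMap (mvfderiv (𝓡 n) (ρ t) y).toLinearMap =
      g.gradSq (ρ t) y := fun y ↦ rfl
  have iI : Integrable (fun y ↦ η y * (g.gradSq (ρ t) y / ρ t y * Real.exp (-V y))) g.riemVolume :=
    integrable_of_continuous_of_hasCompactSupport' hg
      (hηcont.mul ((hQc.div hFc fun y ↦ (hpt y).ne').mul hWc)) hηc.mul_right
  have iX : Integrable (fun y ↦ (1 + Real.log (ρ t y)) * g.innerDual y (mvfderiv (𝓡 n) η y).toLinearMap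
      (mvfderiv (𝓡 n) (ρ t) y).toLinearMap * Real.exp (-V y)) g.riemVolume := by
    refine integrable_of_continuous_of_hasCompactSupport' hg
      (((continuous_const.add hlogc).mul hIηF).mul hWc) ?_
    exact ((HasCompactSupport.intro hKη (hdη0 (G := ρ t))).mul_left).mul_right
  have e1 : ∫ y, g.innerDual y (mvfderiv (𝓡 n) (fun y ↦ η y * (1 + Real.log (ρ t y))) y).toLinearMap
      (mvfderiv (𝓡 n) (ρ t) y).toLinearMap * Real.exp (-V y) ∂g.riemVolume =
      ∫ y, (η y * (g.gradSq (ρ t) y / ρ t y * Real.exp (-V y))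
        + (1 + Real.log (ρ t y)) * g.innerDual y (mvfderiv (𝓡 n) η y).toLinearMap
          (mvfderiv (𝓡 n) (ρ t) y).toLinearMap * Real.exp (-V y)) ∂g.riemVolume := by
    refine integral_congr_ae (Eventually.of_forall fun y ↦ ?_)
    dsimp only
    have hFd : MDifferentiableAt (𝓡 n) 𝓘(ℝ, ℝ) (ρ t) y := hF1.mdifferentiableAt one_ne_zero
    have hlogd : MDifferentiableAt (𝓡 n) 𝓘(ℝ, ℝ) (fun y ↦ 1 + Real.log (ρ t y)) y :=
      ((contMDiff_const.add hlogF1).mdifferentiableAt one_ne_zero)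
    have hsum : (mvfderiv (𝓡 n) (fun y ↦ 1 + Real.log (ρ t y)) y).toLinearMap =
        (mvfderiv (𝓡 n) (fun y ↦ Real.log (ρ t y)) y).toLinearMap := by
      have h1 : (fun y ↦ 1 + Real.log (ρ t y)) = (fun _ ↦ (1 : ℝ)) + fun y ↦ Real.log (ρ t y) := by
        funext z; simp
      rw [h1, mvfderiv_add (mdifferentiableAt_const) (hlogF1.mdifferentiableAt one_ne_zero), mvfderiv_const]
      simp
    rw [innerDual_mvfderiv_mul_left (hη1.mdifferentiableAt one_ne_zero) hlogd, hsum,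
      innerDual_mvfderiv_log_left hFd (hpt y), hgradF y, div_eq_mul_inv]
    ring
  have e2 : ∫ y, (η y * (g.gradSq (ρ t) y / ρ t y * Real.exp (-V y))
        + (1 + Real.log (ρ t y)) * g.innerDual y (mvfderiv (𝓡 n) η y).toLinearMap
          (mvfderiv (𝓡 n) (ρ t) y).toLinearMap * Real.exp (-V y)) ∂g.riemVolume =
      (∫ y, η y * (g.gradSq (ρ t) y / ρ t y * Real.exp (-V y)) ∂g.riemVolume)
        + ∫ y, (1 + Real.log (ρ t y)) * g.innerDual y (mvfderiv (𝓡 n) η y).toLinearMap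
          (mvfderiv (𝓡 n) (ρ t) y).toLinearMap * Real.exp (-V y) ∂g.riemVolume := integral_add iI iX
  -- the boundary term: `∫ (ρ log ρ)(Lη) e^{-V} = −∫ ⟨d(ρ log ρ), dη⟩ e^{-V} = −∫ (1 + log ρ)⟨dη, dρ⟩ e^{-V}`
  have hG' := weightedGreen_right hg (a := fun y ↦ ρ t y * Real.log (ρ t y)) (b := η) (V := V) hPL hη2 hηc hV1
  have e3 : ∫ y, g.innerDual y (mvfderiv (𝓡 n) (fun y ↦ ρ t y * Real.log (ρ t y)) y).toLinearMap
      (mvfderiv (𝓡 n) η y).toLinearMap * Real.exp (-V y) ∂g.riemVolume =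
      ∫ y, (1 + Real.log (ρ t y)) * g.innerDual y (mvfderiv (𝓡 n) η y).toLinearMap
          (mvfderiv (𝓡 n) (ρ t) y).toLinearMap * Real.exp (-V y) ∂g.riemVolume := by
    refine integral_congr_ae (Eventually.of_forall fun y ↦ ?_)
    dsimp only
    rw [innerDual_mvfderiv_mul_log_left (hF1.mdifferentiableAt one_ne_zero) (hpt y),
      g.innerDual_comm y (mvfderiv (𝓡 n) (ρ t) y).toLinearMap]
  rw [e0, hG, e1, e2]
  linarith [hG', e3]

end Entropy

/-- Registered helper `helper_entropyCutoff`: the time derivative of the cut-off entropy along the weighted heat flow on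
a (non-compact) Riemannian manifold modelled on `ℝⁿ` (`entropyCutoff_eq`). [cite: CarrilloNi2009, §3 (3.2)] -/
theorem helper_entropyCutoff : ∀ (n : ℕ) (M : Type*) [TopologicalSpace M] [T2Space M] [SecondCountableTopology M] [ChartedSpace (EuclideanSpace ℝ (Fin n)) M] [IsManifold (𝓡 n) ∞ M] [T3Space M] [MeasurableSpace M] [BorelSpace M] (g : PseudoRiemannianMetric (𝓡 n) ∞ (EuclideanSpace ℝ (Fin n)) (TangentSpace (𝓡 n) : M → Type _)) [g.HasLeviCivita] (V : M → ℝ), g.IsRiemannian → ContMDiff (𝓡 n) 𝓘(ℝ, ℝ) ∞ V → ∀ (ρ : ℝ → M → ℝ) (S : Set ℝ), UniqueDiffOn ℝ S → ContMDiffOn ((𝓡 n).prod 𝓘(ℝ, ℝ)) 𝓘(ℝ, ℝ) ∞ (fun p : M × ℝ ↦ ρ p.2 p.1) (univ ×ˢ S) → (∀ t ∈ S, ∀ y, 0 < ρ t y) → (∀ t ∈ S, ∀ y : M, derivWithin (fun s ↦ ρ s y) S t = g.dalembertian (ρ t) y - g.innerDual y (mvfderiv (𝓡 n) V y).toLinearMap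 (mvfderiv (𝓡 n) (ρ t) y).toLinearMap) → ∀ (η : M → ℝ), ContMDiff (𝓡 n) 𝓘(ℝ, ℝ) ∞ η → HasCompactSupport η → ∀ t ∈ S, ∫ y, η y * derivWithin (fun s ↦ ρ s y * Real.log (ρ s y) * Real.exp (-V y)) S t ∂g.riemVolume = -(∫ y, η y * (g.gradSq (ρ t) y / ρ t y * Real.exp (-V y)) ∂g.riemVolume) + ∫ y, ρ t y * Real.log (ρ t y) * (g.dalembertian η y - g.innerDual y (mvfderiv (𝓡 n) V y).toLinearMap (mvfderiv (𝓡 n) η y).toLinearMap) * Real.exp (-V y) ∂g.riemVolume := by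
  intro n M _ _ _ _ _ _ _ _ g _ V hg hV ρ S hS hρ hpos heq η hη hηc t ht
  exact entropyCutoff_eq hg hV hS hρ hpos heq hη hηc ht

end Summit.SmoothPoincare4.SmoothPoincare4.Theorems.NoncompactShrinkerGapHeat

end
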